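import Summits.Ventures.PackingBounds.Configurations.KerdockCode16
import Summits.Ventures.PackingBounds.Configurations.WeightedListConfig
import Summits.Ventures.PackingBounds.SphericalCodes.DimensionLift

/-!
# Sections of the Kerdock code: `A(15, arccos 1/4) ≥ 156`, `A(15, arccos 1/5) ≥ 128` (shortened Nordstrom–Robinson)

Framing: lottery ticket; floor = certified bounds/negative ranges. Venture `PackingBounds` (cell `pub-packcert`, seat
`pub-packcert-sdp`), ATTAINED side of the B2c cells `(15, 1/4)`, `(15, 1/5)`, `(16, 1/5)`, `(17, 1/5)` (certified
three-point values of record `245`, `142`, `165`, `192` and the Levenshtein column are in PACK-TABLE; no attained entry so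
far at `(15, 1/4)` / `(15, 1/5)`, Leech-section rows `96 → 104` at `(16, 1/5)` and `112` at `(17, 1/5)`).
Two sections of the tree's Kerdock spherical code `Config.KerdockCode16.vecs` (`288` vectors of `ℤ¹⁶` of squared length
`16`: the `256` sign vectors of the Nordstrom–Robinson code `NR(16, 256, 6)` and `±4e_i`; pairwise dot products
`4, 0, -4, -16`, i.e. cosines `≤ 1/4` [Cohn–de Laat–Leijenhorst 2024, §1.2; Conway–Sloane Ch. 2 §8]):
* the hyperplane section orthogonal to `e₀ + e₁`: the `128` sign vectors with `v₀ = -v₁` and the `28` vectors `±4e_i`,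
  `i ≥ 2` — `156` unit vectors with cosines `≤ 1/4` in a `15`-space; entered in the coordinates `(v₀, v₂, …, v₁₅)` with
  weight `2` on the first one (`2v₀v₀' = v₀v₀' + v₁v₁'`), checked by `WeightedListConfig` (`shapeW`, `keysW` by `decide`;
  keys `4, 0, -4, -16`): **`A(15, arccos 1/4) ≥ 156`** (`exists_code_dim15_quarter_156`);
* the shortened Nordstrom–Robinson code: the `128` sign vectors with `v₁₅ = 1`, last coordinate deleted — `(±1)¹⁵`
  vectors at pairwise Hamming distance `6, 8, 10`, dot products `3, -1, -5`, i.e. cosines `1/5, -1/15, -1/3`, with the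
  same distance distribution `70, 15, 42` around every word (`ListConfig`: `shapeOK`, `histOK` by `decide`, energy
  identity): **`A(15, arccos 1/5) ≥ 128`** (`exists_code_dim15_fifth_128`), and by pole lifts
  (`SphericalCodes.exists_code_lift_succ`) **`A(16, arccos 1/5) ≥ 130`**, **`A(17, arccos 1/5) ≥ 132`**.
Kernel brackets with the tree's Levenshtein rows: `156 ≤ A(15, arccos 1/4) ≤ 256`, `128 ≤ A(15, arccos 1/5) ≤ 146`.
For comparison (seat arithmetic, not literature claims): `(±1)`-codes of full length give `A₂(15, 6) = 128` at `(15, 1/4)`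
and `A₂(16, 7) = 36` at `(16, 1/5)`; the seat's Leech-frame numerics reach `135` at `(15, 1/4)`.

## References
* H. Cohn, D. de Laat, N. Leijenhorst, *Optimality of spherical codes via exact semidefinite programming bounds*,
  arXiv:2403.16874 (2024), §1.2 (the Kerdock code `(16, 288, 1/4)`). [`CohnDelaatLeijenhorst2024`]
* J. H. Conway, N. J. A. Sloane, *Sphere Packings, Lattices and Groups*, 3rd ed., Ch. 2 §8 (Nordstrom–Robinson code),
  Ch. 14 Example 3. [`ConwaySloane1999`]
-/

namespace Summit.Ventures.PackingBounds.Config.KerdockSections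

open Finset Summit.Ventures.PackingBounds.Config Summit.Ventures.PackingBounds.Config.Weighted

/-! ## The section orthogonal to `e₀ + e₁`: `156` points, cosines `≤ 1/4`, dimension `15` -/

/-- Rows of the section: for every member `v` of the Kerdock code with `v₀ + v₁ = 0`, the list `(v₀, v₂, …, v₁₅)`. -/
def secRows : List (List ℤ) :=
  (KerdockCode16.vecs.filter fun v => v.getD 0 0 + v.getD 1 0 == 0).map fun v => v.getD 0 0 :: v.drop 2

/-- Weights `(2, 1, …, 1)`: the first coordinate stands for the pair `(v₀, v₁) = (v₀, -v₀)`. -/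
def secWeights : List ℤ := [2, 1, 1, 1, 1, 1, 1, 1, 1, 1, 1, 1, 1, 1, 1]

/-- The weighted products of two distinct rows: `4, 0, -4, -16` (`16 ×` the cosines `1/4, 0, -1/4, -1`). -/
def secKeys : List ℤ := [4, 0, -4, -16]

/-- Kernel check: the section has `156` members. -/
theorem length_secRows : secRows.length = 156 := by decide +kernel

set_option maxRecDepth 100000 in
/-- Kernel check: `15` weights, rows of length `15`, weighted self-products `16`. -/
theorem shape_secRows : shapeW secWeights secRows 15 (16 : ℤ) = true := by decide +kernel

set_option maxRecDepth 100000 in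
/-- Kernel check: every weighted product of two distinct rows is a key. -/
theorem keys_secRows : keysW secWeights secRows secKeys secRows = true := by decide +kernel

/-- `16` is not a key. -/
theorem q_not_secKey : (16 : ℤ) ∉ secKeys := by decide

/-- **`A(15, arccos 1/4) ≥ 156`**: `156` unit vectors of `ℝ¹⁵` with pairwise inner products `≤ 1/4` (the section of the
Kerdock code `(16, 288, 1/4)` orthogonal to `e₀ + e₁`). [cite: CohnDelaatLeijenhorst2024, §1.2] -/
theorem exists_code_dim15_quarter_156 : ∃ C : Finset (EuclideanSpace ℝ (Fin 15)), C.card = 156 ∧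
    (∀ x ∈ C, ‖x‖ = 1) ∧ ∀ x ∈ C, ∀ y ∈ C, x ≠ y → inner ℝ x y ≤ (1 : ℝ) / 4 := by
  obtain ⟨C, hc, h1, h2⟩ := exists_code_weighted (R := ℤ) (ι := Int.castRingHom ℝ) (n := 15)
    (q := (16 : ℤ)) (W := secWeights) (L := secRows) (K := secKeys) Int.cast_injective (by simp)
    (by intro w hw; simp only [secWeights, List.mem_cons, List.not_mem_nil, or_false] at hw
        rcases hw with rfl | rfl | rfl | rfl | rfl | rfl | rfl | rfl | rfl | rfl | rfl | rfl | rfl | rfl | rfl <;> simp)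
    shape_secRows keys_secRows q_not_secKey ((1 : ℝ) / 4)
    (by intro k hk; simp only [secKeys, List.mem_cons, List.not_mem_nil, or_false] at hk
        rcases hk with rfl | rfl | rfl | rfl <;> norm_num)
  exact ⟨C, hc.trans (by rw [length_secRows]), h1, h2⟩

/-! ## The shortened Nordstrom–Robinson code: `128` points, cosines `≤ 1/5`, dimension `15` -/

/-- Rows of the shortened code: the sign vectors of the Kerdock code with last coordinate `1`, truncated to length `15`. -/
def shortRows : List (List ℤ) :=
  (KerdockCode16.vecs.filter fun v => v.getD 15 0 == 1).map fun v => v.take 15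

/-- The distance table of the shortened code: dot products `3` (`70` times: Hamming distance `6`), `-1` (`15` times:
distance `8`), `-5` (`42` times: distance `10`) around every word. -/
def shortTable : List (ℤ × ℕ) := [(3, 70), (-1, 15), (-5, 42)]

/-- Kernel check: `128` words. -/
theorem length_shortRows : shortRows.length = 128 := by decide +kernel

set_option maxRecDepth 100000 in
/-- Kernel check: words of length `15` and self-product `15`. -/
theorem shape_shortRows : shapeOK shortRows 15 (15 : ℤ) = true := by decide +kernel

/-- Kernel check: the keys of the table are distinct and differ from `15`. -/
theorem keys_shortTable : keysOK shortTable (15 : ℤ) = true := by decide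

set_option maxRecDepth 100000 in
/-- Kernel check (distance distribution of the shortened Nordstrom–Robinson code around every word). -/
theorem hist_shortRows : histOK shortRows shortTable shortRows = true := by decide +kernel

/-- The words are pairwise distinct (from the checks). -/
theorem nodup_shortRows : shortRows.Nodup := nodup_of_checks shape_shortRows keys_shortTable hist_shortRows

/-- The shortened Nordstrom–Robinson code as `128` points of `S¹⁴`. -/
noncomputable def shortPts : Finset (EuclideanSpace ℝ (Fin 15)) :=
  config (Int.castRingHom ℝ) 15 (15 : ℤ) shortRows

/-- `ι q > 0`. -/
private theorem hq : 0 < (Int.castRingHom ℝ) (15 : ℤ) := by simp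

/-- `shortPts` has `128` points. -/
theorem card_shortPts : shortPts.card = 128 := by
  rw [shortPts, card_eq Int.cast_injective hq shape_shortRows keys_shortTable hist_shortRows nodup_shortRows,
    length_shortRows]

/-- Every point of `shortPts` is a unit vector. -/
theorem norm_shortPts : ∀ x ∈ shortPts, ‖x‖ = 1 := norm_eq_one hq shape_shortRows

/-- Distinct points of `shortPts` have inner product `1/5`, `-1/15` or `-1/3`; in particular `≤ 1/5`. -/
theorem inner_shortPts_le : ∀ x ∈ shortPts, ∀ y ∈ shortPts, x ≠ y → inner ℝ x y ≤ 1 / 5 := by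
  refine inner_le hq shape_shortRows hist_shortRows (1 / 5) fun p hp => ?_
  simp only [shortTable, List.mem_cons, List.not_mem_nil, or_false] at hp
  rcases hp with rfl | rfl | rfl <;> norm_num

/-- **Energy of the shortened Nordstrom–Robinson code**: for every potential `a`,
`Σ_{x ≠ y ∈ shortPts} a(⟪x,y⟫) = 128 · (70 a(1/5) + 15 a(-1/15) + 42 a(-1/3))`. -/
theorem energy_shortPts (a : ℝ → ℝ) :
    ∑ x ∈ shortPts, ∑ y ∈ shortPts.erase x, a (inner ℝ x y) =
      (128 : ℝ) * (70 * a (1 / 5) + 15 * a (-1 / 15) + 42 * a (-1 / 3)) := by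
  rw [shortPts, energy_eq Int.cast_injective hq shape_shortRows keys_shortTable hist_shortRows nodup_shortRows a,
    length_shortRows]
  simp only [shortTable, List.map_cons, List.map_nil, List.sum_cons, List.sum_nil, Nat.cast_ofNat]
  norm_num
  ring

/-- **`A(15, arccos 1/5) ≥ 128`**: `128` unit vectors of `ℝ¹⁵` with pairwise inner products `≤ 1/5` (the shortened
Nordstrom–Robinson code `(15, 128, 6)` as sign vectors). [cite: ConwaySloane1999, Ch. 2 §8] -/
theorem exists_code_dim15_fifth_128 : ∃ C : Finset (EuclideanSpace ℝ (Fin 15)), C.card = 128 ∧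
    (∀ x ∈ C, ‖x‖ = 1) ∧ ∀ x ∈ C, ∀ y ∈ C, x ≠ y → inner ℝ x y ≤ 1 / 5 :=
  ⟨shortPts, card_shortPts, norm_shortPts, inner_shortPts_le⟩

/-- **`A(16, arccos 1/5) ≥ 130`**: the shortened Nordstrom–Robinson code with two poles.
[cite: ConwaySloane1999, Ch. 14 Example 3] -/
theorem exists_code_dim16_fifth_130 : ∃ C : Finset (EuclideanSpace ℝ (Fin 16)), C.card = 130 ∧
    (∀ x ∈ C, ‖x‖ = 1) ∧ ∀ x ∈ C, ∀ y ∈ C, x ≠ y → inner ℝ x y ≤ 1 / 5 := by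
  obtain ⟨C, hc, h1, h2⟩ := exists_code_dim15_fifth_128
  obtain ⟨C', hc', h1', h2'⟩ := SphericalCodes.exists_code_lift_succ (by norm_num) C h1 h2
  exact ⟨C', by rw [hc', hc], h1', h2'⟩

/-- **`A(17, arccos 1/5) ≥ 132`** (two lifts of the shortened Nordstrom–Robinson code).
[cite: ConwaySloane1999, Ch. 14 Example 3] -/
theorem exists_code_dim17_fifth_132 : ∃ C : Finset (EuclideanSpace ℝ (Fin 17)), C.card = 132 ∧
    (∀ x ∈ C, ‖x‖ = 1) ∧ ∀ x ∈ C, ∀ y ∈ C, x ≠ y → inner ℝ x y ≤ 1 / 5 := by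
  obtain ⟨C, hc, h1, h2⟩ := exists_code_dim16_fifth_130
  obtain ⟨C', hc', h1', h2'⟩ := SphericalCodes.exists_code_lift_succ (by norm_num) C h1 h2
  exact ⟨C', by rw [hc', hc], h1', h2'⟩

end Summit.Ventures.PackingBounds.Config.KerdockSections
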